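import Summits.AtomisticToContinuum.Crystallization.Theorems.HullExactificationCascadeHullGoodEverywhereDefs
import Literature.MathematicalPhysics.StatisticalMechanics.LocalMatchingCompactness

/-!
# `HullGoodEverywhere` (route `HullExactificationCascade`, item D): local convergence toolkit

Elementary facts about a sequence of `δ`-separated point sets `Y k ⊆ ℝ³` converging locally
(`BallMatch ε R 0 (Y k) S` eventually, for all `R`, `ε > 0`) to a `δ`-separated `S`:

* `hge_mem_of_tendsto` — limits of (eventual) members of `Y k` belong to `S`;
* `hge_exists_approx` — every point of `S` is the limit of a sequence of members (`nearPt`);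
* `hge_frequently_exists_of_finite` — pigeonhole: eventually-some-label ⟹ some label frequently;
* `hge_extract_isometry` — sequential compactness of the linear isometries of `ℝ³`
  (operator-norm form), and `hge_extract_bounded` — Bolzano–Weierstrass for a real sequence and
  a family of finitely many bounded vector sequences, jointly.
-/

noncomputable section

namespace Summit.AtomisticToContinuum.Crystallization.Theorems

open Literature.MathematicalPhysics.StatisticalMechanics Literature.Geometry.DiscreteGeometry
open Filter Topology Metric

/-! ## Minimisers in separated sets -/

/-- In a `δ`-separated set meeting the closed unit ball about `z`, some point within distance `1`
of `z` minimises the distance to `z`. [folklore] -/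
theorem hge_exists_minimiser {Y : Set (EuclideanSpace ℝ (Fin 3))} {δ : ℝ} (hδ : 0 < δ)
    (hsep : ∀ p ∈ Y, ∀ q ∈ Y, p ≠ q → δ ≤ dist p q) {z : (EuclideanSpace ℝ (Fin 3))} (h : ∃ b ∈ Y, dist b z ≤ 1) :
    ∃ a ∈ Y, dist a z ≤ 1 ∧ ∀ b ∈ Y, dist b z ≤ 1 → dist a z ≤ dist b z := by
  classical
  have hfin : (Y ∩ closedBall z 1).Finite :=
    finite_of_forall_le_dist_of_subset_closedBall hδ
      (fun p hp q hq hpq => hsep p hp.1 q hq.1 hpq) Set.inter_subset_right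
  obtain ⟨b, hb, hbz⟩ := h
  have hne : hfin.toFinset.Nonempty := ⟨b, by simpa using ⟨hb, hbz⟩⟩
  obtain ⟨a, ha, hmin⟩ := Finset.exists_min_image hfin.toFinset (fun a => dist a z) hne
  simp only [Set.Finite.mem_toFinset, Set.mem_inter_iff, mem_closedBall] at ha hmin
  exact ⟨a, ha.1, ha.2, fun b hb hbz => hmin b ⟨hb, hbz⟩⟩

/-- For a `δ`-separated `Y` meeting the closed unit ball about `z`, `nearPt Y z` is a point of `Y`
at distance `≤ 1` from `z`, at least as close to `z` as any point of `Y` within `1`. [folklore] -/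
theorem hge_nearPt {Y : Set (EuclideanSpace ℝ (Fin 3))} {δ : ℝ} (hδ : 0 < δ)
    (hsep : ∀ p ∈ Y, ∀ q ∈ Y, p ≠ q → δ ≤ dist p q) {z : (EuclideanSpace ℝ (Fin 3))} (h : ∃ b ∈ Y, dist b z ≤ 1) :
    nearPt Y z ∈ Y ∧ dist (nearPt Y z) z ≤ 1 ∧
      ∀ b ∈ Y, dist b z ≤ 1 → dist (nearPt Y z) z ≤ dist b z :=
  nearPt_spec (hge_exists_minimiser hδ hsep h)

/-! ## Limits of members, approximating sequences -/

section Convergence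

variable {Y : ℕ → Set (EuclideanSpace ℝ (Fin 3))} {S : Set (EuclideanSpace ℝ (Fin 3))} {δ : ℝ}

/-- **Limits of members lie in the limit set.** If `Y k → S` locally, `S` is `δ`-separated, and
`a k ∈ Y k` eventually with `a k → z`, then `z ∈ S`. [folklore] -/
theorem hge_mem_of_tendsto (hδ : 0 < δ) (hSsep : ∀ p ∈ S, ∀ q ∈ S, p ≠ q → δ ≤ dist p q)
    (hlim : ∀ R ε : ℝ, 0 < ε → ∀ᶠ k in atTop, BallMatch ε R 0 (Y k) S)
    {a : ℕ → (EuclideanSpace ℝ (Fin 3))} {z : (EuclideanSpace ℝ (Fin 3))} (ha : ∀ᶠ k in atTop, a k ∈ Y k) (haz : Tendsto a atTop (𝓝 z)) :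
    z ∈ S := by
  classical
  by_contra hz
  -- a positive lower bound `η` for the distances from `z` to the points of `S` within `1`
  have hfin : (S ∩ closedBall z 1).Finite :=
    finite_of_forall_le_dist_of_subset_closedBall hδ
      (fun p hp q hq hpq => hSsep p hp.1 q hq.1 hpq) Set.inter_subset_right
  obtain ⟨η, hη0, hη⟩ : ∃ η : ℝ, 0 < η ∧ ∀ s ∈ S, dist s z ≤ 1 → η ≤ dist s z := by
    by_cases hne : hfin.toFinset.Nonempty
    · obtain ⟨s₀, hs₀, hmin⟩ := Finset.exists_min_image hfin.toFinset (fun s => dist s z) hne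
      simp only [Set.Finite.mem_toFinset, Set.mem_inter_iff, mem_closedBall] at hs₀ hmin
      refine ⟨dist s₀ z, dist_pos.2 (fun h => hz (h ▸ hs₀.1)), fun s hs hsz => hmin s ⟨hs, hsz⟩⟩
    · refine ⟨1, one_pos, fun s hs hsz => ?_⟩
      exact absurd ⟨s, by simpa using ⟨hs, hsz⟩⟩ hne
  set ε : ℝ := min η 1 / 3 with hε
  have hε0 : 0 < ε := by positivity
  have hεη : 3 * ε ≤ η := by
    have : min η 1 ≤ η := min_le_left _ _
    rw [hε]; linarith
  have hε1 : 3 * ε ≤ 1 := by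
    have : min η 1 ≤ 1 := min_le_right _ _
    rw [hε]; linarith
  have h1 : ∀ᶠ k in atTop, dist (a k) z < ε := Metric.tendsto_nhds.1 haz ε hε0
  obtain ⟨k, hak, hk1, hk2⟩ := (ha.and (h1.and (hlim (‖z‖ + 1) ε hε0))).exists
  have hnorm : dist (a k) 0 ≤ ‖z‖ + 1 := by
    rw [dist_zero_right]
    have := norm_le_norm_add_norm_sub' (a k) z
    rw [← dist_eq_norm] at this
    linarith
  obtain ⟨s, hs, hs'⟩ := hk2.2 (a k) hak hnorm
  have hsz : dist s z ≤ 2 * ε := by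
    have := dist_triangle s (a k) z
    rw [dist_comm s (a k)] at this
    linarith
  have := hη s hs (by linarith)
  linarith

/-- **Approximating sequences.** If `Y k → S` locally, all `Y k` are `δ`-separated and `z ∈ S`,
then `nearPt (Y k) z ∈ Y k` eventually and `nearPt (Y k) z → z`. [folklore] -/
theorem hge_exists_approx (hδ : 0 < δ) (hYsep : ∀ k, ∀ p ∈ Y k, ∀ q ∈ Y k, p ≠ q → δ ≤ dist p q)
    (hlim : ∀ R ε : ℝ, 0 < ε → ∀ᶠ k in atTop, BallMatch ε R 0 (Y k) S) {z : (EuclideanSpace ℝ (Fin 3))} (hz : z ∈ S) :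
    (∀ᶠ k in atTop, nearPt (Y k) z ∈ Y k) ∧ Tendsto (fun k => nearPt (Y k) z) atTop (𝓝 z) := by
  have key : ∀ ε : ℝ, 0 < ε → ε ≤ 1 →
      ∀ᶠ k in atTop, nearPt (Y k) z ∈ Y k ∧ dist (nearPt (Y k) z) z ≤ ε := by
    intro ε hε hε1
    filter_upwards [hlim ‖z‖ ε hε] with k hk
    obtain ⟨b, hb, hbz⟩ := hk.1 z hz (by rw [dist_zero_right])
    have h := hge_nearPt hδ (hYsep k) ⟨b, hb, hbz.trans hε1⟩
    exact ⟨h.1, (h.2.2 b hb (hbz.trans hε1)).trans hbz⟩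
  refine ⟨(key 1 one_pos le_rfl).mono fun k hk => hk.1, Metric.tendsto_nhds.2 fun ε hε => ?_⟩
  filter_upwards [key (min ε 1 / 2) (by positivity)
    (by have := min_le_right ε 1; linarith)] with k hk
  have := min_le_left ε 1
  linarith [hk.2]

/-- Distances pass to the limit along members: if `a k → z`, `b k → w` then
`dist (a k) (b k) → dist z w`; in particular a uniform lower bound persists. [folklore] -/
theorem hge_le_dist_of_tendsto {a b : ℕ → (EuclideanSpace ℝ (Fin 3))} {z w : (EuclideanSpace ℝ (Fin 3))} {c : ℝ} (ha : Tendsto a atTop (𝓝 z))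
    (hb : Tendsto b atTop (𝓝 w)) (h : ∃ᶠ k in atTop, c ≤ dist (a k) (b k)) : c ≤ dist z w :=
  ge_of_tendsto_of_frequently (ha.dist hb) h

end Convergence

/-! ## Pigeonhole along a filter -/

/-- If eventually some label from a finite type works, then some fixed label works frequently.
[folklore] -/
theorem hge_frequently_exists_of_finite {ι : Type*} [Finite ι] {p : ℕ → ι → Prop}
    (h : ∀ᶠ k in atTop, ∃ v, p k v) : ∃ v, ∃ᶠ k in atTop, p k v := by
  by_contra hcon
  push Not at hcon
  have hall : ∀ᶠ k in atTop, ∀ v, ¬ p k v := Filter.eventually_all.2 hcon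
  obtain ⟨k, ⟨v, hv⟩, hk⟩ := (h.and hall).exists
  exact hk v hv

/-! ## Extraction: linear isometries and bounded data -/

/-- The linear isometries of `ℝ³`, as continuous linear maps, form a compact set (closed and
bounded in a finite-dimensional space). [folklore] -/
theorem hge_isCompact_isometries :
    IsCompact {f : (EuclideanSpace ℝ (Fin 3)) →L[ℝ] (EuclideanSpace ℝ (Fin 3)) | ∀ v, ‖f v‖ = ‖v‖} := by
  have hclosed : IsClosed {f : (EuclideanSpace ℝ (Fin 3)) →L[ℝ] (EuclideanSpace ℝ (Fin 3)) | ∀ v, ‖f v‖ = ‖v‖} := by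
    rw [Set.setOf_forall]
    refine isClosed_iInter fun v => ?_
    exact isClosed_eq ((ContinuousLinearMap.apply ℝ (EuclideanSpace ℝ (Fin 3)) v).continuous.norm) continuous_const
  refine (isCompact_closedBall (0 : (EuclideanSpace ℝ (Fin 3)) →L[ℝ] (EuclideanSpace ℝ (Fin 3))) 1).of_isClosed_subset hclosed ?_
  intro f hf
  rw [mem_closedBall, dist_zero_right]
  exact ContinuousLinearMap.opNorm_le_bound f zero_le_one fun v => by rw [hf v, one_mul]

/-- **Sequential compactness of `O(3)`.** Every sequence of linear isometries of `ℝ³` has a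
subsequence converging to a linear isometry, uniformly on bounded sets:
`‖A (ψ k) v - Alim v‖ ≤ ε ‖v‖` for all `v`, eventually in `k`. [folklore] -/
theorem hge_extract_isometry (A : ℕ → ((EuclideanSpace ℝ (Fin 3)) →ₗᵢ[ℝ] (EuclideanSpace ℝ (Fin 3)))) :
    ∃ (ψ : ℕ → ℕ) (Alim : (EuclideanSpace ℝ (Fin 3)) →ₗᵢ[ℝ] (EuclideanSpace ℝ (Fin 3))), StrictMono ψ ∧
      ∀ ε : ℝ, 0 < ε → ∀ᶠ k in atTop, ∀ v : (EuclideanSpace ℝ (Fin 3)), ‖A (ψ k) v - Alim v‖ ≤ ε * ‖v‖ := by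
  set f : ℕ → ((EuclideanSpace ℝ (Fin 3)) →L[ℝ] (EuclideanSpace ℝ (Fin 3))) := fun k => (A k).toContinuousLinearMap with hf
  have hmem : ∀ k, f k ∈ {f : (EuclideanSpace ℝ (Fin 3)) →L[ℝ] (EuclideanSpace ℝ (Fin 3)) | ∀ v, ‖f v‖ = ‖v‖} := fun k v => (A k).norm_map v
  obtain ⟨F, hF, ψ, hψ, hlim⟩ := hge_isCompact_isometries.tendsto_subseq hmem
  let Alim : (EuclideanSpace ℝ (Fin 3)) →ₗᵢ[ℝ] (EuclideanSpace ℝ (Fin 3)) := ⟨F.toLinearMap, fun v => hF v⟩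
  refine ⟨ψ, Alim, hψ, fun ε hε => ?_⟩
  have h1 : ∀ᶠ k in atTop, dist (f (ψ k)) F < ε := Metric.tendsto_nhds.1 hlim ε hε
  filter_upwards [h1] with k hk v
  rw [dist_eq_norm] at hk
  have h2 : ‖(f (ψ k) - F) v‖ ≤ ‖f (ψ k) - F‖ * ‖v‖ := ContinuousLinearMap.le_opNorm _ _
  have h3 : (f (ψ k) - F) v = A (ψ k) v - Alim v := rfl
  rw [h3] at h2
  exact h2.trans (mul_le_mul_of_nonneg_right hk.le (norm_nonneg v))

/-- **Bolzano–Weierstrass, jointly.** A real sequence with values in `[a, b]` and finitely many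
vector sequences bounded by `C` have a common convergent subsequence. [folklore] -/
theorem hge_extract_bounded {ι : Type*} [Fintype ι] {a b C : ℝ} (d : ℕ → ℝ) (w : ℕ → ι → (EuclideanSpace ℝ (Fin 3)))
    (hd : ∀ k, d k ∈ Set.Icc a b) (hw : ∀ k i, ‖w k i‖ ≤ C) :
    ∃ (ψ : ℕ → ℕ) (dlim : ℝ) (wlim : ι → (EuclideanSpace ℝ (Fin 3))), StrictMono ψ ∧ dlim ∈ Set.Icc a b ∧
      Tendsto (fun k => d (ψ k)) atTop (𝓝 dlim) ∧
      ∀ i, Tendsto (fun k => w (ψ k) i) atTop (𝓝 (wlim i)) := by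
  set K : Set (ℝ × (ι → (EuclideanSpace ℝ (Fin 3)))) := Set.Icc a b ×ˢ closedBall 0 (max C 0) with hK
  have hKc : IsCompact K := isCompact_Icc.prod (isCompact_closedBall 0 (max C 0))
  have hmem : ∀ k, (d k, w k) ∈ K := fun k => by
    refine ⟨hd k, ?_⟩
    rw [mem_closedBall, dist_zero_right, pi_norm_le_iff_of_nonneg (le_max_right C 0)]
    exact fun i => (hw k i).trans (le_max_left _ _)
  obtain ⟨⟨dlim, wlim⟩, hmemK, ψ, hψ, hlim⟩ := hKc.tendsto_subseq hmem
  refine ⟨ψ, dlim, wlim, hψ, hmemK.1, ?_, fun i => ?_⟩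
  · exact (continuous_fst.tendsto _).comp hlim
  · have h2 : Tendsto (fun k => w (ψ k)) atTop (𝓝 wlim) := (continuous_snd.tendsto _).comp hlim
    exact tendsto_pi_nhds.1 h2 i

end Summit.AtomisticToContinuum.Crystallization.Theorems

end
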